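import Mathlib
import Summits.NavierStokesRegularity.NavierStokesRegularity.Theorems.EulerZoomLiouvillePowerGaugeEulerLiouvilleGalileanWandering
import HarnessLib

/-!
# Crux E `PowerGaugeEulerLiouville` (stmt-NavierStokesRegularity-19832), line `galilean-frames`: THE MEMBER-LEVEL KILL OF WANDERING MEMBERS
# WITH NON-CONSTANT SIMILARITY DRIFT (for the LEAD's `IsPastSteady` alternatives of `Lines/birth.lean`; width seat ns-ezl-w3 g5)

Route №10 `EulerZoomLiouville` (NavierStokesRegularity), crux E.  Companion of `…GalileanWandering` (`wanderingReduce` = F3 of the line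
`galilean-frames`): the dichotomy «trivial ∨ anchored» of a WANDERING self-similar member `u(τ,y) = (T−τ)^{γ−1}V((T−τ)^{−γ}(y − ξ(τ))) + η(τ)`
is decided by the SIMILARITY DRIFT `d(τ) = (T−τ)^{1−γ} ξ'(τ)`.  This file states the kill half at member level, in the binder shape the LEAD
wires as a past alternative:

* `wandering_ae_eq_zero_of_drift_ne` — crux hypotheses verbatim (`0 < ρ ≤ 1/2`) + the wandering representation (`T₁ ≤ 0`, `T₁ ≤ T`, `ξ ∈ C¹`)
  + two times `τ₁, τ₂ < T₁` with `d(τ₁) ≠ d(τ₂)` ⇒ `u = 0` a.e. on the slab.  (When `d` is constant on the window the member is EXACTLY an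
  anchored self-similar member, `GalileanFrames.wandering_ae_eq_zero_or_selfSimilar`, and falls under the existing past-self-similar strata.)
  Every BOOSTED (`ξ = x₀ + wτ`, `w ≠ 0`) or ACCELERATING centre has non-constant drift.

WHAT THIS IS NOT: not NS regularity, not the crux E — a symmetry stratum of the crux CLASS 19832 (MODEL lattice; E/NS strata) in member form;
`--supports` stmt-19832; 19832 OPEN. [folklore; MajdaBertozzi2002 Prop. 1.1 p. 12]
-/

noncomputable section

-- flat `Theorems/<Route><Decl>…` files of one crux share the namespace of the crux (tree convention: `Summit.<S>.<S>.…`)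
set_option linter.dupNamespace false

open MeasureTheory Set Filter Topology Metric Function TopologicalSpace InnerProductSpace
open scoped ENNReal NNReal RealInnerProductSpace

namespace Summit.NavierStokesRegularity.NavierStokesRegularity.Theorems.PowerGaugeEulerLiouville

namespace GalileanFrames

open Literature.Analysis Literature.Analysis.FunctionSpaces Literature.Analysis.FluidPDE
open Summit.NavierStokesRegularity.NavierStokesRegularity.Theorems.PowerGaugeEulerLiouville

variable {u : ℝ → EuclideanSpace ℝ (Fin 3) → EuclideanSpace ℝ (Fin 3)} {p : ℝ → EuclideanSpace ℝ (Fin 3) → ℝ}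
  {H : ℝ → EuclideanSpace ℝ (Fin 3) → EuclideanSpace ℝ (Fin 3) →L[ℝ] EuclideanSpace ℝ (Fin 3)} {c : ℝ≥0}
  {V : EuclideanSpace ℝ (Fin 3) → EuclideanSpace ℝ (Fin 3)} {ξ η : ℝ → EuclideanSpace ℝ (Fin 3)} {T T₁ : ℝ}

/-- **WANDERING MEMBERS WITH NON-CONSTANT SIMILARITY DRIFT ARE TRIVIAL** (member-level kill half of F3 of line `galilean-frames`;
`0 < ρ ≤ 1/2`, `γ = 1/(2+ρ)`): crux hypotheses verbatim, `u τ = fun y => (T−τ)^{γ−1} • V ((T−τ)^{−γ} • (y − ξ τ)) + η τ` for `τ < T₁`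
(`T₁ ≤ 0`, `T₁ ≤ T`, `ξ ∈ C¹`), and two times `τ₁, τ₂ < T₁` with `(T−τ₁)^{1−γ} ξ'(τ₁) ≠ (T−τ₂)^{1−γ} ξ'(τ₂)` ⇒ `u = 0` a.e. on the slab.
[folklore; MajdaBertozzi2002 Prop. 1.1 p. 12] -/
theorem wandering_ae_eq_zero_of_drift_ne {ρ : ℝ} (hρ : 0 < ρ) (hρ2 : ρ ≤ 1 / 2)
    (hsw : IsSuitableWeakSolutionOn (slab (EuclideanSpace ℝ (Fin 3)) (Iio 0) isOpen_Iio) 0 0 u p)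
    (hH : HasWeakSpatialGradientOn (slab (EuclideanSpace ℝ (Fin 3)) (Iio 0) isOpen_Iio) u H)
    (hc : ∀ a : ℝ, 0 < a → ENNReal.ofReal (a ^ (2 * ρ)) * cknA a (0 : ℝ × EuclideanSpace ℝ (Fin 3)) u +
        ENNReal.ofReal (a ^ ρ) * cknE a (0 : ℝ × EuclideanSpace ℝ (Fin 3)) H +
        ENNReal.ofReal (a ^ (2 * ρ)) * cknD a (0 : ℝ × EuclideanSpace ℝ (Fin 3)) p ≤ (c : ℝ≥0∞))
    (hT₁ : T₁ ≤ 0) (hT : T₁ ≤ T) (hξ : ContDiff ℝ 1 ξ)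
    (hu : ∀ τ : ℝ, τ < T₁ → u τ = fun y =>
      (T - τ) ^ (1 / (2 + ρ) - 1) • V ((T - τ) ^ (-(1 / (2 + ρ))) • (y - ξ τ)) + η τ)
    {τ₁ τ₂ : ℝ} (hτ₁ : τ₁ < T₁) (hτ₂ : τ₂ < T₁)
    (hdrift : (T - τ₁) ^ (1 - 1 / (2 + ρ)) • deriv ξ τ₁ ≠ (T - τ₂) ^ (1 - 1 / (2 + ρ)) • deriv ξ τ₂) :
    uncurry u =ᵐ[volume.restrict (Iio (0 : ℝ) ×ˢ (univ : Set (EuclideanSpace ℝ (Fin 3))))] 0 := by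
  set γ : ℝ := 1 / (2 + ρ) with hγdef
  have hγ : 0 < γ := by rw [hγdef]; positivity
  have hγ1 : γ ≤ 1 := by
    rw [hγdef, div_le_one (by linarith)]; linarith
  have hA : ∀ a : ℝ, 0 < a → ENNReal.ofReal (a ^ (2 * ρ)) * cknA a (0 : ℝ × EuclideanSpace ℝ (Fin 3)) u ≤ (c : ℝ≥0∞) :=
    fun a ha => le_trans (le_trans le_self_add le_self_add) (hc a ha)
  have hsol : IsDistributionalNSSolutionOn (slab (EuclideanSpace ℝ (Fin 3)) (Iio 0) isOpen_Iio) 0 0 u p := hsw.distributional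
  -- ### a good slice: the profile is measurable and locally integrable
  have hne : (ae (volume.restrict (Iio T₁))).NeBot := by
    rw [ae_neBot, Ne, Measure.restrict_eq_zero, Real.volume_Iio]; exact ENNReal.top_ne_zero
  obtain ⟨τ', hτ'W, hτ'T⟩ := ((FrameSteady.ae_hasWeakFDerivOn_slice_past hH hT₁).and (ae_restrict_mem measurableSet_Iio)).exists
  have hτ'T : τ' < T₁ := hτ'T
  have hl' : 0 < T - τ' := by linarith
  have hs' : 0 < (T - τ') ^ γ := Real.rpow_pos_of_pos hl' _
  have hul : LocallyIntegrable (u τ') volume :=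
    locallyIntegrableOn_univ.1 (by simpa only [Opens.coe_top] using hτ'W.locallyIntegrableOn)
  have hVeq : V = fun Y => (T - τ') ^ (1 - γ) • (u τ' (ξ τ' + (T - τ') ^ γ • Y) - η τ') := by
    funext Y
    rw [hu τ' hτ'T]
    simp only [add_sub_cancel_left, smul_smul, Real.rpow_neg hl'.le, inv_mul_cancel₀ hs'.ne', one_smul, add_sub_cancel_right]
    rw [← Real.rpow_add hl', show (1 - γ + (γ - 1) : ℝ) = 0 by ring, Real.rpow_zero, one_smul]
  have hVm : AEStronglyMeasurable V volume := by
    rw [hVeq]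
    exact ((hul.aestronglyMeasurable.comp_quasiMeasurePreserving (Past.quasiMeasurePreserving_add_smul hs'.ne' (ξ τ'))).sub
      aestronglyMeasurable_const).const_smul ((T - τ') ^ (1 - γ))
  have hVl : LocallyIntegrable V volume := by
    rw [hVeq]
    have h1 := locallyIntegrable_comp_add_right_general hul (ξ τ')
    have h2 := locallyIntegrable_comp_smul h1 hs'.ne'
    have h3 : LocallyIntegrable (fun Y => u τ' (ξ τ' + (T - τ') ^ γ • Y)) volume :=
      h2.congr (Eventually.of_forall fun Y => by simp only [add_comm])
    have h4 : LocallyIntegrable (fun Y => u τ' (ξ τ' + (T - τ') ^ γ • Y) - η τ') volume :=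
      h3.sub (locallyIntegrable_const _)
    simpa only [Pi.smul_def] using h4.smul ((T - τ') ^ (1 - γ))
  -- ### (1) the background is slaved to the clock; absorb it
  set t₀ : ℝ := T₁ - 1 with ht₀
  have ht₀T : t₀ < T₁ := by rw [ht₀]; linarith
  set κ₀ : EuclideanSpace ℝ (Fin 3) := (T - t₀) ^ (1 - γ) • η t₀ with hκ₀
  have hκ : ∀ τ : ℝ, τ < T₁ → (T - τ) ^ (1 - γ) • η τ = κ₀ := fun τ hτ =>
    wandering_background_const hρ hρ2 hA hT₁ hT hVm hu hτ ht₀T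
  set Vt : EuclideanSpace ℝ (Fin 3) → EuclideanSpace ℝ (Fin 3) := fun Y => V Y + κ₀ with hVt
  have hu' : ∀ τ : ℝ, τ < T₁ → u τ = fun y => (T - τ) ^ (γ - 1) • Vt ((T - τ) ^ (-γ) • (y - ξ τ)) := by
    intro τ hτ
    have hl : 0 < T - τ := by linarith
    rw [hu τ hτ]
    funext y
    simp only [hVt, smul_add]
    congr 1
    rw [← hκ τ hτ, smul_smul, ← Real.rpow_add hl, show (γ - 1 + (1 - γ) : ℝ) = 0 by ring, Real.rpow_zero, one_smul]
  have hVtm : AEStronglyMeasurable Vt volume := hVm.add aestronglyMeasurable_const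
  have hVtl : LocallyIntegrable Vt volume := hVl.add (locallyIntegrable_const _)
  -- ### (2) growth of `Vt` and `|Vt|² ∈ L¹_loc`
  obtain ⟨Cg, hCgtop, hgrow⟩ := wandering_profile_growth hρ hρ2 hA hT₁ hT ht₀T (hu t₀ ht₀T)
  have hgrowVt : ∀ L : ℝ, 1 ≤ L → ∫⁻ Y in ball (0 : EuclideanSpace ℝ (Fin 3)) L, ‖Vt Y‖ₑ ^ 2 ≤ Cg * ENNReal.ofReal (L ^ (1 - 2 * ρ)) :=
    fun L hL => hgrow L hL
  have hVt2 : LocallyIntegrable (fun Y => ‖Vt Y‖ ^ 2) volume := by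
    refine EnergySaturation.locallyIntegrable_norm_sq_of_growth_loc (ρ := ρ) hVtm (c := Cg.toNNReal) fun L hL => ?_
    rw [ENNReal.coe_toNNReal hCgtop]
    exact hgrowVt L hL
  have hgrowC : ∀ R : ℝ, 1 ≤ R → ∫⁻ z in ball (0 : EuclideanSpace ℝ (Fin 3)) R, ‖Vt z + 0‖ₑ ^ 2 ≤
      ENNReal.ofReal (Cg.toReal * R ^ (1 - 2 * ρ)) := by
    intro R hR
    simp only [add_zero]
    rw [ENNReal.ofReal_mul ENNReal.toReal_nonneg, ENNReal.ofReal_toReal hCgtop]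
    exact hgrowVt R hR
  -- ### (3) weak divergence freeness and the drift condition; invariance along drift increments
  have hdivU : ∀ φ : EuclideanSpace ℝ (Fin 3) → ℝ, ContDiff ℝ (⊤ : ℕ∞) φ → HasCompactSupport φ →
      ∫ z, ⟪Vt z, gradient φ z⟫ = 0 :=
    fun φ hφ hφc => wandering_profile_integral_inner_gradient_eq_zero hsol hT₁ hT hγ hγ1 hξ hVtl hu' hφ hφc
  set d : ℝ → EuclideanSpace ℝ (Fin 3) := fun τ => (T - τ) ^ (1 - γ) • deriv ξ τ with hd
  have hinv : ∀ τ₁ τ₂ : ℝ, τ₁ < T₁ → τ₂ < T₁ → ∀ s : ℝ, (fun z => Vt (z + s • (d τ₁ - d τ₂))) =ᵐ[volume] Vt := by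
    intro τ₁ τ₂ hτ₁ hτ₂ s
    refine harmonicShearVanishes ρ hρ Vt 0 (d τ₁ - d τ₂) Cg.toReal hVtl hgrowC hdivU ?_ s
    intro Φ hΦ hΦc htr
    exact wandering_drift_weaklyGradient hsol hT₁ hT hγ hγ1 hξ hVtm hVtl hVt2 hu' ⟨hΦ, hΦc, by simp⟩ htr hτ₁ hτ₂
  -- ### a non-zero invariance direction: the profile vanishes, the member is quiescent
  have he : d τ₁ - d τ₂ ≠ 0 := sub_ne_zero.2 hdrift
  have hVt0 : Vt =ᵐ[volume] 0 :=
    ae_eq_zero_of_translationInvariant_of_growth hVtm he (hinv τ₁ τ₂ hτ₁ hτ₂) hCgtop (by linarith) (by linarith) hgrowVt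
  have hslice0 : ∀ τ : ℝ, τ < T₁ → u τ =ᵐ[volume] 0 := by
    intro τ hτ
    have hl : 0 < T - τ := by linarith
    have hdτ : (T - τ) ^ (-γ) ≠ 0 := (Real.rpow_pos_of_pos hl _).ne'
    have h1 := (Past.quasiMeasurePreserving_smul_sub hdτ (ξ τ)).ae_eq_comp hVt0
    rw [hu' τ hτ]
    filter_upwards [h1] with y hy
    simp only [comp_apply, Pi.zero_apply] at hy
    simp [hy]
  refine ae_eq_zero_of_gauge_of_energyVanishing_allRho hρ.le hsw hH hc fun ε hε N => ?_
  have hsub : Iio (min (-N) T₁) ⊆ {s : ℝ | s < -N ∧ ∫⁻ x, ‖u s x‖ₑ ^ 2 ≤ ENNReal.ofReal ε} := by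
    intro s hs
    rw [mem_Iio, lt_min_iff] at hs
    refine ⟨hs.1, ?_⟩
    have hae : (fun x => ‖u s x‖ₑ ^ 2) =ᵐ[volume] fun _ => 0 := by
      filter_upwards [hslice0 s hs.2] with x hx
      simp [hx]
    rw [lintegral_congr_ae hae, lintegral_zero]
    exact zero_le
  intro h0
  have h := measure_mono_null hsub h0
  rw [Real.volume_Iio] at h
  exact ENNReal.top_ne_zero h

end GalileanFrames

end Summit.NavierStokesRegularity.NavierStokesRegularity.Theorems.PowerGaugeEulerLiouville
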